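import Mathlib

/-!
# Pinned diagram exchange on cylinders — core part 1 (generic, Mathlib-only)

Helper file toward the stub `stub_DiagramExchange` of the line `pinned-diagram-exchange` (crux
stmt-CriticalPhenomena-5076): the pinned Yang–Baxter identity `DiagramExchangeAt L` on all cylinders `ℤ/L`, `L ≥ 3`,
by a train argument in the coloured partition category (see the final file for the overview).

PART 1: local pieces, the hexagon template, the three KERNEL CHECKS, and the certified closure with the
reflection lemmas turning the checks into usable statements.
-/

namespace Summit.CriticalPhenomena.CardyFormulaZ2.Theorems.IKLinearTransport.PinnedDiagramExchange

namespace DX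

open SimpleGraph

/-! ## §1 Local pieces, the hexagon template, and the kernel checks -/

/-- Piece kinds: a double face `D τ₀ τ₁` (column types), the intertwiners `R`, `R'`, the identity. [folklore] -/
inductive Kind
  | D (τ₀ τ₁ : Bool)
  | R
  | R'
  | I
  deriving DecidableEq

/-- `√3 ∈ ℤ√3`. [folklore] -/
def sq3 : ℤ√3 := ⟨0, 1⟩

/-- Four times the face weight `faceWeight`. [folklore] -/
def fwZ (iso odd anti : Bool) : ℤ√3 :=
  if iso then (if odd then sq3 else 2) else (if anti then 4 else 0)

/-- Rhombus weight (corners `a`, `lo`, `b`, `hi` in cyclic order; `bits.1`: vertical diagonal). [folklore] -/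
def rhW (rc x y : ℤ√3) (ca cb clo chi : Bool) (bits : Bool × Bool) : ℤ√3 :=
  if bits.2 then 0 else
  if (ca == cb) && (cb == clo) && (clo == chi) then (if bits.1 then 0 else 1)
  else if (ca == cb) && (clo == chi) then (if bits.1 then y else x)
  else if ((ca == clo) && (cb == chi)) || ((ca == chi) && (cb == clo)) then (if bits.1 then 0 else 1)
  else (if bits.1 then 0 else rc)

/-- Piece weight from the six local colours `a b c d lo hi` and the two bits. [folklore] -/
def pieceW : Kind → (ca cb cc cd clo chi : Bool) → Bool × Bool → ℤ√3
  | .D τ₀ τ₁, ca, cb, cc, cd, clo, chi, bits =>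
      fwZ τ₀ ((ca ^^ clo) ^^ (cc ^^ chi)) bits.1 * fwZ τ₁ ((clo ^^ cb) ^^ (chi ^^ cd)) bits.2
  | .R, ca, cb, _, _, clo, chi, bits => rhW (-sq3) 2 (-1) ca cb clo chi bits
  | .R', ca, cb, _, _, clo, chi, bits => rhW sq3 (-1) 2 ca cb clo chi bits
  | .I, _, _, _, _, clo, chi, bits => if (clo == chi) && (bits == (false, false)) then 1 else 0

/-- Conditional edge. [folklore] -/
def ce {W : Type*} (p : Bool) (u v : W) : List (W × W) := if p then [(u, v)] else []

/-- Rhombus edges (only monochromatic ones). [folklore] -/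
def rhE {W : Type*} (ca cb clo chi d : Bool) (a b vl vh : W) : List (W × W) :=
  ce (ca == clo) a vl ++ ce (clo == cb) vl b ++ ce (cb == chi) b vh ++ ce (chi == ca) vh a ++
  ce (d && (clo == chi)) vl vh ++ ce (!d && (ca == cb)) a b

/-- Piece edges (only monochromatic ones), polymorphic in the vertex type. [folklore] -/
def pieceE {W : Type*} : Kind → (ca cb cc cd clo chi : Bool) → Bool × Bool →
    (a b c d vl vh : W) → List (W × W)
  | .D _ _, ca, cb, cc, cd, clo, chi, bits, a, b, c, d, vl, vh =>
      ce (ca == cc) a c ++ ce (cb == cd) b d ++ ce (ca == clo) a vl ++ ce (clo == cb) vl b ++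
      ce (cc == chi) c vh ++ ce (chi == cd) vh d ++ ce (clo == chi) vl vh ++
      ce (bits.1 && (cc == clo)) c vl ++ ce (!bits.1 && (ca == chi)) a vh ++
      ce (bits.2 && (chi == cb)) vh b ++ ce (!bits.2 && (clo == cd)) vl d
  | .R, ca, cb, _, _, clo, chi, bits, a, b, _, _, vl, vh => rhE ca cb clo chi bits.1 a b vl vh
  | .R', ca, cb, _, _, clo, chi, bits, a, b, _, _, vl, vh => rhE ca cb clo chi bits.1 a b vl vh
  | .I, ca, cb, _, _, clo, chi, _, a, b, _, _, vl, vh =>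
      ce (ca == clo) a vl ++ ce (clo == cb) vl b ++ ce (ca == chi) a vh ++ ce (chi == cb) vh b ++
      ce (clo == chi) vl vh

/-- A two-piece window: lower kind, upper kind, whether the upper piece sits one row higher. [folklore] -/
structure WinDesc where
  lo : Kind
  hi : Kind
  shift : Bool

/-- In-window configuration: middle colour, lower bits, upper bits. [folklore] -/
abbrev WinIn : Type := Bool × (Bool × Bool) × (Bool × Bool)

/-- Window edges on the template `Fin 7` (`0:a 1:b 2:c 3:d 4:lo 5:hi 6:m`). [folklore] -/
def winE (d : WinDesc) (c0 c1 c2 c3 c4 c5 : Bool) (x : WinIn) : List (Fin 7 × Fin 7) :=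
  pieceE d.lo c0 c1 c2 c3 c4 x.1 x.2.1 0 1 2 3 4 6 ++
  (if d.shift then pieceE d.hi c2 c3 c2 c3 x.1 c5 x.2.2 2 3 2 3 6 5
   else pieceE d.hi c0 c1 c2 c3 x.1 c5 x.2.2 0 1 2 3 6 5)

/-- Window weight. [folklore] -/
def winW (d : WinDesc) (c0 c1 c2 c3 c4 c5 : Bool) (x : WinIn) : ℤ√3 :=
  pieceW d.lo c0 c1 c2 c3 c4 x.1 x.2.1 *
  (if d.shift then pieceW d.hi c2 c3 c2 c3 x.1 c5 x.2.2 else pieceW d.hi c0 c1 c2 c3 x.1 c5 x.2.2)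

/-- One relaxation step along an edge. [folklore] -/
def rstep (S : ℕ) (e : Fin 7 × Fin 7) : ℕ :=
  if S.testBit e.1.val || S.testBit e.2.val then S ||| 2 ^ e.1.val ||| 2 ^ e.2.val else S

/-- One relaxation pass. [folklore] -/
def relax (es : List (Fin 7 × Fin 7)) (S : ℕ) : ℕ := es.foldl rstep S

/-- Reach-set bitmask after four passes. [folklore] -/
def reach (es : List (Fin 7 × Fin 7)) (src : Fin 7) : ℕ := (relax es)^[4] (2 ^ src.val)

/-- Closedness of a bitmask under the edges. [folklore] -/
def closedB (es : List (Fin 7 × Fin 7)) (S : ℕ) : Bool :=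
  es.all fun e => S.testBit e.1.val == S.testBit e.2.val

/-- The six boundary reach sets. [folklore] -/
def reaches (es : List (Fin 7 × Fin 7)) : List ℕ :=
  [reach es 0, reach es 1, reach es 2, reach es 3, reach es 4, reach es 5]

/-- Boundary signature. [folklore] -/
def sig (es : List (Fin 7 × Fin 7)) : List ℕ := (reaches es).map (· % 64)

/-- Table entry. [folklore] -/
structure Entry where
  sg : List ℕ
  w : ℤ√3
  ok : Bool

/-- The four bit pairs. [folklore] -/
def allBits : List (Bool × Bool) := [(false, false), (false, true), (true, false), (true, true)]

/-- All in-window configurations. [folklore] -/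
def allCin : List WinIn :=
  [false, true].flatMap fun cm => allBits.flatMap fun bl => allBits.map fun bh => (cm, bl, bh)

/-- Entry of one in-configuration. [folklore] -/
def mkEntry (es : List (Fin 7 × Fin 7)) (w : ℤ√3) : Entry :=
  let rs := reaches es
  ⟨rs.map (· % 64), w, rs.all (closedB es)⟩

/-- Table of a window (nonzero weights only). [folklore] -/
def table (d : WinDesc) (c0 c1 c2 c3 c4 c5 : Bool) : List Entry :=
  allCin.filterMap fun x =>
    let w := winW d c0 c1 c2 c3 c4 c5 x
    if w = 0 then none else some (mkEntry (winE d c0 c1 c2 c3 c4 c5 x) w)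

/-- Fibre sum. [folklore] -/
def sumAt (t : List Entry) (σ : List ℕ) : ℤ√3 :=
  t.foldr (fun e acc => (if e.sg = σ then e.w else 0) + acc) 0

/-- Per-boundary-colouring check of a windowed identity `κ·[dL] ≡ κ'·[dR]`. [folklore] -/
def checkCb (dL dR : WinDesc) (κ κ' : ℤ√3) (c0 c1 c2 c3 c4 c5 : Bool) : Bool :=
  let tL := table dL c0 c1 c2 c3 c4 c5
  let tR := table dR c0 c1 c2 c3 c4 c5
  (tL.all (·.ok) && tR.all (·.ok)) &&
  (tL ++ tR).all fun e => decide (κ * sumAt tL e.sg = κ' * sumAt tR e.sg)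

/-- YBE, left: `D(hc,iso)` below `R` (one row up). [folklore] -/
def ybeL : WinDesc := ⟨.D false true, .R, true⟩
/-- YBE, right: `R` below `D(iso,hc)`. [folklore] -/
def ybeR : WinDesc := ⟨.R, .D true false, false⟩
/-- Two identity pieces. [folklore] -/
def idid : WinDesc := ⟨.I, .I, false⟩
/-- `R` below `R'`. [folklore] -/
def rrp : WinDesc := ⟨.R, .R', false⟩
/-- `R'` below `R`. [folklore] -/
def rpr : WinDesc := ⟨.R', .R, false⟩

set_option maxHeartbeats 1000000 in
/-- KERNEL CHECK 1: the partition-level Yang–Baxter relation. [folklore] -/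
theorem check_ybe (c0 c1 c2 c3 c4 c5 : Bool) : checkCb ybeL ybeR 1 1 c0 c1 c2 c3 c4 c5 = true := by
  revert c0 c1 c2 c3 c4 c5; decide +kernel

set_option maxHeartbeats 1000000 in
/-- KERNEL CHECK 2: inversion relation `-2·[id,id] ≡ [R below R']` (the pieces ignore `c2 c3`). [folklore] -/
theorem check_inv1 (c0 c1 c2 c3 c4 c5 : Bool) : checkCb idid rrp (-2) 1 c0 c1 c2 c3 c4 c5 = true := by
  revert c0 c1 c4 c5
  exact show ∀ c0 c1 c4 c5 : Bool, checkCb idid rrp (-2) 1 c0 c1 false false c4 c5 = true by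
    decide +kernel

set_option maxHeartbeats 1000000 in
/-- KERNEL CHECK 3: inversion relation `[R' below R] ≡ -2·[id,id]`. [folklore] -/
theorem check_inv2 (c0 c1 c2 c3 c4 c5 : Bool) : checkCb rpr idid 1 (-2) c0 c1 c2 c3 c4 c5 = true := by
  revert c0 c1 c4 c5
  exact show ∀ c0 c1 c4 c5 : Bool, checkCb rpr idid 1 (-2) c0 c1 false false c4 c5 = true by
    decide +kernel

/-! ## §2 The certified closure: soundness, closedness, reflection of the kernel checks -/

/-- The template graph of an edge list. [folklore] -/
def H (es : List (Fin 7 × Fin 7)) : SimpleGraph (Fin 7) := fromRel fun x y => (x, y) ∈ es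

/-- A relaxation step only adds bits. [folklore] -/
theorem rstep_mono (S : ℕ) (e : Fin 7 × Fin 7) (v : ℕ) (h : S.testBit v = true) :
    (rstep S e).testBit v = true := by
  unfold rstep; split <;> simp [Nat.testBit_or, h]

/-- A relaxation pass only adds bits. [folklore] -/
theorem relax_mono (l : List (Fin 7 × Fin 7)) (S : ℕ) (v : ℕ) (h : S.testBit v = true) :
    (l.foldl rstep S).testBit v = true := by
  induction l generalizing S with
  | nil => exact h
  | cons e l ih => exact ih _ (rstep_mono S e v h)

/-- The source is in its reach set. [folklore] -/
theorem reach_self (es : List (Fin 7 × Fin 7)) (a : Fin 7) : (reach es a).testBit a.val = true := by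
  unfold reach
  suffices h : ∀ n S, S.testBit a.val = true → ((relax es)^[n] S).testBit a.val = true from
    h 4 _ Nat.testBit_two_pow_self
  intro n
  induction n with
  | zero => intro S h; simpa using h
  | succ n ih => intro S h; rw [Function.iterate_succ_apply']; exact relax_mono es _ _ (ih S h)

/-- Soundness of one relaxation step: marked vertices are reachable. [folklore] -/
theorem rstep_sound (es : List (Fin 7 × Fin 7)) (e : Fin 7 × Fin 7) (he : e ∈ es) (a : Fin 7) (S : ℕ)
    (hS : ∀ v : Fin 7, S.testBit v.val = true → (H es).Reachable a v) (v : Fin 7)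
    (hv : (rstep S e).testBit v.val = true) : (H es).Reachable a v := by
  unfold rstep at hv
  split at hv
  · rename_i hc
    have hadj : e.1 = e.2 ∨ (H es).Adj e.1 e.2 := by
      by_cases h' : e.1 = e.2
      · exact Or.inl h'
      · exact Or.inr ⟨h', Or.inl (by simpa using he)⟩
    have h12 : (H es).Reachable a e.1 ∧ (H es).Reachable a e.2 := by
      rcases Bool.or_eq_true_iff.1 hc with h1 | h2
      · have r1 := hS _ h1
        exact ⟨r1, hadj.elim (fun h' => h' ▸ r1) fun h' => r1.trans h'.reachable⟩
      · have r2 := hS _ h2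
        exact ⟨hadj.elim (fun h' => h'.symm ▸ r2) fun h' => r2.trans h'.reachable.symm, r2⟩
    simp only [Nat.testBit_or, Nat.testBit_two_pow, Bool.or_eq_true, decide_eq_true_eq] at hv
    rcases hv with (hv | hv) | hv
    · exact hS v hv
    · exact (Fin.ext hv : e.1 = v) ▸ h12.1
    · exact (Fin.ext hv : e.2 = v) ▸ h12.2
  · exact hS v hv

/-- Soundness of a relaxation pass. [folklore] -/
theorem relax_sound (es l : List (Fin 7 × Fin 7)) (hl : ∀ e ∈ l, e ∈ es) (a : Fin 7) (S : ℕ)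
    (hS : ∀ v : Fin 7, S.testBit v.val = true → (H es).Reachable a v) :
    ∀ v : Fin 7, (l.foldl rstep S).testBit v.val = true → (H es).Reachable a v := by
  induction l generalizing S with
  | nil => simpa using hS
  | cons e l ih =>
    rw [List.foldl_cons]
    exact ih (fun e' he' => hl e' (List.mem_cons_of_mem _ he')) _
      (rstep_sound es e (hl e List.mem_cons_self) a S hS)

/-- Soundness of the reach set: marked vertices are reachable. [folklore] -/
theorem reach_sound (es : List (Fin 7 × Fin 7)) (a v : Fin 7) (h : (reach es a).testBit v.val = true) :
    (H es).Reachable a v := by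
  unfold reach at h
  suffices hh : ∀ n S, (∀ v : Fin 7, S.testBit v.val = true → (H es).Reachable a v) →
      ∀ v : Fin 7, ((relax es)^[n] S).testBit v.val = true → (H es).Reachable a v by
    refine hh 4 _ (fun w hw => ?_) v h
    rw [Nat.testBit_two_pow, decide_eq_true_eq] at hw
    exact (Fin.ext hw : a = w) ▸ Reachable.refl _
  intro n
  induction n with
  | zero => intro S hS; simpa using hS
  | succ n ih =>
    intro S hS w hw
    rw [Function.iterate_succ_apply'] at hw
    exact relax_sound es es (fun _ h => h) a _ (ih S hS) w hw

/-- A closed bit-mask is constant along paths. [folklore] -/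
theorem closed_reach (es : List (Fin 7 × Fin 7)) (S : ℕ) (hc : closedB es S = true) {a b : Fin 7}
    (h : (H es).Reachable a b) : S.testBit a.val = S.testBit b.val := by
  have hc' : ∀ e ∈ es, S.testBit e.1.val = S.testBit e.2.val := by
    intro e he
    have := List.all_eq_true.1 hc e he
    simpa using this
  obtain ⟨p⟩ := h
  induction p with
  | nil => rfl
  | @cons u v w hadj p ih =>
    rw [← ih]
    rcases hadj with ⟨-, h | h⟩
    · exact hc' (u, v) h
    · exact (hc' (v, u) h).symm

/-- Certified closure: once the computed reach set is closed, it IS the reachability relation. [folklore] -/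
theorem reach_iff (es : List (Fin 7 × Fin 7)) (a b : Fin 7) (hc : closedB es (reach es a) = true) :
    (H es).Reachable a b ↔ (reach es a).testBit b.val = true :=
  ⟨fun h => by rw [← closed_reach es _ hc h]; exact reach_self es a, reach_sound es a b⟩

/-- `allCin` enumerates every in-window configuration. [folklore] -/
theorem mem_allCin (x : WinIn) : x ∈ allCin := by
  rcases x with ⟨_ | _, ⟨_ | _, _ | _⟩, ⟨_ | _, _ | _⟩⟩ <;> decide

/-- `allCin` has no duplicates. [folklore] -/
theorem allCin_nodup : allCin.Nodup := by decide

/-- Sums over in-window configurations as a fold over `allCin`. [folklore] -/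
theorem sum_winIn {M : Type*} [AddCommMonoid M] (f : WinIn → M) :
    ∑ x, f x = allCin.foldr (fun x acc => f x + acc) 0 := by
  classical
  have huniv : (Finset.univ : Finset WinIn) = allCin.toFinset := by
    ext x; simp [mem_allCin]
  rw [huniv, List.sum_toFinset _ allCin_nodup, List.sum_eq_foldr, List.foldr_map]

/-- Reading the signature. [folklore] -/
theorem sig_getD (es : List (Fin 7 × Fin 7)) (a : Fin 6) :
    (sig es).getD a.val 0 = reach es a.castSucc % 64 := by
  fin_cases a <;> rfl

/-- The fibre sum of the table is the fibre sum over all in-window configurations. [folklore] -/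
theorem sumAt_table (d : WinDesc) (c0 c1 c2 c3 c4 c5 : Bool) (σ : List ℕ) :
    sumAt (table d c0 c1 c2 c3 c4 c5) σ =
      ∑ x : WinIn, (if sig (winE d c0 c1 c2 c3 c4 c5 x) = σ then winW d c0 c1 c2 c3 c4 c5 x else 0) := by
  rw [sum_winIn, sumAt, table, List.foldr_filterMap]
  congr 1
  funext x acc
  by_cases h : winW d c0 c1 c2 c3 c4 c5 x = 0
  · simp [h]
  · simp only [h, ↓reduceIte]
    rfl

/-- A fibre sum over a signature absent from the table vanishes. [folklore] -/
theorem sumAt_eq_zero (t : List Entry) (σ : List ℕ) (h : ∀ e ∈ t, e.sg ≠ σ) : sumAt t σ = 0 := by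
  induction t with
  | nil => rfl
  | cons e t ih =>
    have h1 : e.sg ≠ σ := h e List.mem_cons_self
    have h2 := ih fun e' he' => h e' (List.mem_cons_of_mem _ he')
    simp only [sumAt, List.foldr_cons, h1, ↓reduceIte, zero_add] at h2 ⊢
    exact h2

/-- Nonzero-weight configurations have an entry in the table. [folklore] -/
theorem mem_table {d : WinDesc} {c0 c1 c2 c3 c4 c5 : Bool} (x : WinIn)
    (hx : winW d c0 c1 c2 c3 c4 c5 x ≠ 0) :
    mkEntry (winE d c0 c1 c2 c3 c4 c5 x) (winW d c0 c1 c2 c3 c4 c5 x) ∈ table d c0 c1 c2 c3 c4 c5 := by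
  rw [table, List.mem_filterMap]
  exact ⟨x, mem_allCin x, by simp [hx]⟩

/-- Reflection, transfer part: the kernel check yields the windowed transfer identity for EVERY
signature. [folklore] -/
theorem check_transfer {dL dR : WinDesc} {κ κ' : ℤ√3} {c0 c1 c2 c3 c4 c5 : Bool}
    (hck : checkCb dL dR κ κ' c0 c1 c2 c3 c4 c5 = true) (σ : List ℕ) :
    κ * ∑ x : WinIn, (if sig (winE dL c0 c1 c2 c3 c4 c5 x) = σ then winW dL c0 c1 c2 c3 c4 c5 x else 0) =
    κ' * ∑ x : WinIn, (if sig (winE dR c0 c1 c2 c3 c4 c5 x) = σ then winW dR c0 c1 c2 c3 c4 c5 x else 0) := by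
  rw [← sumAt_table, ← sumAt_table]
  simp only [checkCb, Bool.and_eq_true, List.all_eq_true, decide_eq_true_eq] at hck
  obtain ⟨-, hall⟩ := hck
  by_cases h : ∃ e ∈ table dL c0 c1 c2 c3 c4 c5 ++ table dR c0 c1 c2 c3 c4 c5, e.sg = σ
  · obtain ⟨e, he, rfl⟩ := h
    exact hall e he
  · simp only [not_exists, not_and] at h
    rw [sumAt_eq_zero _ _ fun e he => h e (List.mem_append_left _ he),
      sumAt_eq_zero _ _ fun e he => h e (List.mem_append_right _ he), mul_zero, mul_zero]

/-- Reflection, closure part: for a nonzero-weight in-configuration of the LEFT window the computed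
signature is the template reachability. [folklore] -/
theorem check_closedL {dL dR : WinDesc} {κ κ' : ℤ√3} {c0 c1 c2 c3 c4 c5 : Bool}
    (hck : checkCb dL dR κ κ' c0 c1 c2 c3 c4 c5 = true) (x : WinIn)
    (hx : winW dL c0 c1 c2 c3 c4 c5 x ≠ 0) (a b : Fin 6) :
    (H (winE dL c0 c1 c2 c3 c4 c5 x)).Reachable a.castSucc b.castSucc ↔
      ((sig (winE dL c0 c1 c2 c3 c4 c5 x)).getD a.val 0).testBit b.val = true := by
  simp only [checkCb, Bool.and_eq_true, List.all_eq_true] at hck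
  have hok := hck.1.1 _ (mem_table x hx)
  simp only [mkEntry, List.all_eq_true] at hok
  have hc : closedB (winE dL c0 c1 c2 c3 c4 c5 x) (reach (winE dL c0 c1 c2 c3 c4 c5 x) a.castSucc) = true :=
    hok _ (by fin_cases a <;> simp [reaches])
  rw [reach_iff _ _ _ hc, sig_getD, show (64 : ℕ) = 2 ^ 6 by norm_num, Nat.testBit_mod_two_pow]
  simp [b.isLt]

/-- The same for the RIGHT window. [folklore] -/
theorem check_closedR {dL dR : WinDesc} {κ κ' : ℤ√3} {c0 c1 c2 c3 c4 c5 : Bool}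
    (hck : checkCb dL dR κ κ' c0 c1 c2 c3 c4 c5 = true) (x : WinIn)
    (hx : winW dR c0 c1 c2 c3 c4 c5 x ≠ 0) (a b : Fin 6) :
    (H (winE dR c0 c1 c2 c3 c4 c5 x)).Reachable a.castSucc b.castSucc ↔
      ((sig (winE dR c0 c1 c2 c3 c4 c5 x)).getD a.val 0).testBit b.val = true := by
  simp only [checkCb, Bool.and_eq_true, List.all_eq_true] at hck
  have hok := hck.1.2 _ (mem_table x hx)
  simp only [mkEntry, List.all_eq_true] at hok
  have hc : closedB (winE dR c0 c1 c2 c3 c4 c5 x) (reach (winE dR c0 c1 c2 c3 c4 c5 x) a.castSucc) = true :=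
    hok _ (by fin_cases a <;> simp [reaches])
  rw [reach_iff _ _ _ hc, sig_getD, show (64 : ℕ) = 2 ^ 6 by norm_num, Nat.testBit_mod_two_pow]
  simp [b.isLt]

end DX

/-- REGISTERED SUB-GOAL of part 1: the three kernel-checked partition-level identities (Yang–Baxter hexagon and
the two inversion relations of the signed intertwiner). [folklore] -/
theorem diagramExchange_kernelChecks : (∀ c0 c1 c2 c3 c4 c5 : Bool, DX.checkCb DX.ybeL DX.ybeR 1 1 c0 c1 c2 c3 c4 c5 = true) ∧ (∀ c0 c1 c2 c3 c4 c5 : Bool, DX.checkCb DX.idid DX.rrp (-2) 1 c0 c1 c2 c3 c4 c5 = true) ∧ (∀ c0 c1 c2 c3 c4 c5 : Bool, DX.checkCb DX.rpr DX.idid 1 (-2) c0 c1 c2 c3 c4 c5 = true) :=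
  ⟨DX.check_ybe, DX.check_inv1, DX.check_inv2⟩

end Summit.CriticalPhenomena.CardyFormulaZ2.Theorems.IKLinearTransport.PinnedDiagramExchange
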